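/-
Copyright (c) 2026 the pub-hodgecm-mathlib formalisation cell (harness21).  Prover seat hodgecm-mathlib-K2E3-p03 (g5), Track B «K2-LIT» ∕ h413
(`stmt-HodgeConjecture-24833`), line `K2_E3_EllipticInputs`, unit U12, road «GL-[M6]-sc» (line lead K2E3-p23 (g5), RULINGS #14 (M14-1), 2026-09-04T07:23Z),
brick «VOL-transfer»: EVERY HAAR MEASURE OF `G' = GL₃(F) ⧸ ϖ^ℤ·1` IS A CONSTANT MULTIPLE OF `(ν|_D).map mk`, AND THE VOLUME OF THE CONJUGATION-MEMBERSHIP SETS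
`{x̄ ∈ Ω R : x̄ · mk g · x̄⁻¹ ∈ Ω m}` OF `G'` IS THAT CONSTANT TIMES THE HAAR VOLUME OF `{z ∈ D : 𝔅_R(z), 𝔅_m(z g z⁻¹)}` UPSTAIRS IN `GL₃(F)`.  2026-09-04.
-/
import Summits.HodgeConjecture.HodgeConjecture.Theorems.K2E3GL3ModUniformizerHaarTransfer   -- ★ B4-1m F2 (this lineage, g4) p858140: `isHaarMeasure_map_mk_restrict`, `map_mk_restrict_apply`; brings ★ F1 p858113 (`D`, `isCompact_inter_preimage_mk`) and the `G'` frame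
import Summits.HodgeConjecture.HodgeConjecture.Theorems.K2E3GL3HeightBallExhaustion          -- ★ B4-0 file 2 (K2E3-p14 (g5)): `isCompact_image_mk_setOf_adBall`; brings ★ B4-0 file 1 `isOpen_setOf_adBall` (the balls `𝔅_m`)
import Mathlib.MeasureTheory.Integral.Bochner.Set
import HarnessLib

/-!
# K2_E3 road (h413), road «GL-[M6]-sc», brick «VOL-transfer» — Haar volumes of conjugation-membership sets of `G' = GL₃(F) ⧸ ϖ^ℤ·1`, read upstairs

Cell `pub/hodgecm-mathlib` (D-0151), Track B (21-frontier RULING «PUSH BOTH» 2026-09-03, director req624), seat K2E3-p03 (g5); by-name deal (M14-1) of the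
line lead K2E3-p23 (g5), squad bus 2026-09-04T07:23:02Z.  `--supports stmt-HodgeConjecture-24833 --as helper`; THEOREMS ONLY (no definition ∕ instance ∕
notation ∕ named fact ∕ `sorry`); never imports `Cruxes/…/Lines`.  COUNT-NEUTRAL: the glue between the UPSTAIRS volume counts of the road (★ VOL-split
`K2E3GL3SplitConjugacyVolume.exists_measure_window_adBall_conj_le`, VOL-mixed) and the line lead's assembly ASM (`K2E3NonEllEstimatesOfRadius.nonEllEstimates_of_radius`,
hypothesis (hball)) at `G'`.

Frame (verbatim ★ B4-1m): `G' := GL (Fin 3) F ⧸ N'`, `N' := (Subgroup.zpowers (Units.mk0 ϖ hϖ0)).map (Matrix.GeneralLinearGroup.scalar (Fin 3))`, the window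
`D := {z | WithZero.log (Valued.v (det z)) ∈ Icc (−2) 0}` (★ F1: a clopen fundamental domain, `mk|_D : D ≃ₜ G'`), `μ₁ := (ν.restrict D).map mk` (★ F2: a Haar
measure of `G'` for `ν` a Haar measure of `GL₃(F)`).  The exhaustion `Ω` is taken ABSTRACTLY: any family `Ω : ℕ → Set G'` together with a family of sets upstairs
`B : ℕ → Set (GL (Fin 3) F)` and the membership law `hmem : ∀ m g, mk g ∈ Ω m ↔ g ∈ B m` — for the road, `B m = 𝔅_m = {g | ∀ i j k l, |ϖ^m g_{ij} (g⁻¹)_{kl}| ≤ 1}`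
(★ B4-0) and `Ω` = ★ `K2E3GL3HeightBallExhaustion.exists_adHeightBall_compactExhaustion_quotScalar` (its conjunct (i) IS `hmem`); §4 spells this case out.

THE RESULTS.
* §1 (any group quotient, pure algebra) `preimage_mk_setOf_mem_and_conj_mem` — `mk⁻¹ {x̄ | x̄ ∈ Ω R ∧ x̄ · mk g · x̄⁻¹ ∈ Ω m} = {z | z ∈ B R ∧ z g z⁻¹ ∈ B m}`;
  `eq_image_mk_of_forall_mk_mem_iff` (`Ω m = mk '' B m`), `preimage_mk_eq_of_forall_mk_mem_iff` (`mk⁻¹ (Ω m) = B m`), `isOpen_of_forall_mk_mem_iff` ∕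
  `isClosed_of_forall_mk_mem_iff` (openness ∕ closedness of `B m` descends), `measurableSet_setOf_mem_and_conj_mem`.
* §2 (Haar uniqueness; `F` a non-archimedean local field) **`exists_eq_smul_map_mk_restrict`** — for `ν` a Haar measure of `GL₃(F)` and `μ'` ANY Haar measure of `G'`:
  `∃ c : ℝ≥0, μ' = c • (ν.restrict D).map mk` (Mathlib `isMulLeftInvariant_eq_smul` over ★ F2 `isHaarMeasure_map_mk_restrict`; `G'` is second countable and
  locally compact as a quotient of `GL₃(F)`, ★ GL-P), and **`exists_forall_measure_eq_mul_measure_preimage_inter`** — `∃ c : ℝ≥0, ∀ A measurable,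
  μ' A = c · ν (mk⁻¹ A ∩ D)`.
* §3 THE BRICK **`exists_forall_measure_setOf_mem_and_conj_mem_eq`** — `∃ c : ℝ≥0, ∀ g R m, μ' {x̄ | x̄ ∈ Ω R ∧ x̄ · mk g · x̄⁻¹ ∈ Ω m} =
  c · ν {z | log v(det z) ∈ Icc (−2) 0 ∧ z ∈ B R ∧ z g z⁻¹ ∈ B m}` (ONE constant for all `g, R, m`; EQUALITY), its `lintegral` form
  `lintegral_indicator_comp_conj_eq` (`∫⁻ x̄ in Ω R, 𝟙_{Ω m}(x̄ · mk g · x̄⁻¹) ∂μ' = μ' {…}`), and the Bochner form ASM's (hball) eats,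
  **`setIntegral_norm_comp_conj_le`** — for `θ : G' → E` with `‖θ‖ ≤ M` vanishing off `Ω m` and `μ' (Ω R) < ∞`:
  `∫ x̄ in Ω R, ‖θ (x̄ · mk g · x̄⁻¹)‖ ∂μ' ≤ M · (μ' {…}).toReal`.
* §4 the road's case `B = 𝔅` spelled out: `exists_forall_measure_adBall_conj_eq` and `setIntegral_norm_comp_conj_le_adBall` (no measurability ∕ finiteness
  hypotheses left: `Ω m = mk '' 𝔅_m` is clopen and compact, ★ B4-0).
[WeilIntegration1965, §7–§8 (quotient measures, uniqueness); Cartier1979, §I.3–I.4 (the groups `G ∕ ϖ^ℤ`); HarishChandra1970, Part VII §3 p. 70 (truncated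
orbital integrals `∫_{Ω_T} θ(x γ x⁻¹) dx` modulo a discrete cocompact central subgroup)]
HONEST LABEL: HC_CM is proved only modulo the 7 printed citations (2 remaining named inputs: hLiu418 = stmt-HodgeConjecture-24832, h413 =
stmt-HodgeConjecture-24833) until rung 0 closes; count-neutral helper.

## References
* [WeilIntegration1965] A. Weil, *L'intégration dans les groupes topologiques et ses applications*, 2e éd. (1965), §7–§8.
* [Cartier1979] P. Cartier, *Representations of p-adic groups: a survey*, Corvallis (1979), §I.3–I.4.
* [HarishChandra1970] Harish-Chandra (notes by G. van Dijk), *Harmonic Analysis on Reductive p-adic Groups*, LNM 162 (1970), Part VII §3.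
-/

set_option autoImplicit false
set_option linter.dupNamespace false   -- `Summit.HodgeConjecture.HodgeConjecture.…` (D-0017 nested layout; lakefile exemption for Summits)

noncomputable section

open MeasureTheory Measure Topology
open scoped Matrix MatrixGroups WithZero ENNReal NNReal
open Summit.HodgeConjecture.HodgeConjecture.Cruxes.H413.K2E3GL3ModCentre
open Summit.HodgeConjecture.HodgeConjecture.Cruxes.H413.K2E3GL3ModCocompactCentral
open Summit.HodgeConjecture.HodgeConjecture.Cruxes.H413.K2E3GL3ModUniformizerCocompact
open Summit.HodgeConjecture.HodgeConjecture.Cruxes.H413.K2E3GL3ModUniformizerFundamentalDomain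
open Summit.HodgeConjecture.HodgeConjecture.Cruxes.H413.K2E3GL3ModUniformizerHaarTransfer
open Summit.HodgeConjecture.HodgeConjecture.Cruxes.H413.K2E3GLnAdHeightBalls
open Summit.HodgeConjecture.HodgeConjecture.Cruxes.H413.K2E3GL3HeightBallExhaustion

namespace Summit.HodgeConjecture.HodgeConjecture.Cruxes.H413.K2E3GL3ModUniformizerVolumeTransfer

/-! ## §1  The conjugation-membership sets and their preimages upstairs (any topological group, any normal subgroup) -/

section Algebra

variable {G : Type*} [Group G] (N : Subgroup G) [N.Normal]

/-- **`mk⁻¹ {x̄ | x̄ ∈ Ω R ∧ x̄ · mk g · x̄⁻¹ ∈ Ω m} = {z | z ∈ B R ∧ z g z⁻¹ ∈ B m}`** whenever `mk z ∈ Ω n ↔ z ∈ B n` for all `n, z`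
(`mk z · mk g · (mk z)⁻¹ = mk (z g z⁻¹)`). [cite: WeilIntegration1965, §7] -/
theorem preimage_mk_setOf_mem_and_conj_mem (Ω : ℕ → Set (G ⧸ N)) (B : ℕ → Set G)
    (hmem : ∀ (n : ℕ) (z : G), (QuotientGroup.mk z : G ⧸ N) ∈ Ω n ↔ z ∈ B n) (g : G) (R m : ℕ) :
    (QuotientGroup.mk : G → G ⧸ N) ⁻¹' {x | x ∈ Ω R ∧ x * QuotientGroup.mk g * x⁻¹ ∈ Ω m} = {z | z ∈ B R ∧ z * g * z⁻¹ ∈ B m} := by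
  ext z
  rw [Set.mem_preimage, Set.mem_setOf_eq, Set.mem_setOf_eq, ← QuotientGroup.mk_mul, ← QuotientGroup.mk_inv, ← QuotientGroup.mk_mul, hmem, hmem]

omit [N.Normal] in
/-- `Ω m = mk '' B m` under the membership law. [folklore] -/
theorem eq_image_mk_of_forall_mk_mem_iff (Ω : ℕ → Set (G ⧸ N)) (B : ℕ → Set G)
    (hmem : ∀ (n : ℕ) (z : G), (QuotientGroup.mk z : G ⧸ N) ∈ Ω n ↔ z ∈ B n) (m : ℕ) :
    Ω m = (QuotientGroup.mk : G → G ⧸ N) '' B m := by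
  ext x
  obtain ⟨z, rfl⟩ := QuotientGroup.mk_surjective x
  refine ⟨fun hx => ⟨z, (hmem m z).1 hx, rfl⟩, ?_⟩
  rintro ⟨z', hz', hzz'⟩
  rw [← hzz']
  exact (hmem m z').2 hz'

omit [N.Normal] in
/-- `mk⁻¹ (Ω m) = B m` under the membership law. [folklore] -/
theorem preimage_mk_eq_of_forall_mk_mem_iff (Ω : ℕ → Set (G ⧸ N)) (B : ℕ → Set G)
    (hmem : ∀ (n : ℕ) (z : G), (QuotientGroup.mk z : G ⧸ N) ∈ Ω n ↔ z ∈ B n) (m : ℕ) :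
    (QuotientGroup.mk : G → G ⧸ N) ⁻¹' Ω m = B m := by
  ext z
  rw [Set.mem_preimage, hmem]

variable [TopologicalSpace G] [IsTopologicalGroup G]

omit [N.Normal] in
/-- Openness descends: if `B m` is open then `Ω m = mk '' B m` is open (`mk` is an open map). [cite: Cartier1979, §I.3] -/
theorem isOpen_of_forall_mk_mem_iff (Ω : ℕ → Set (G ⧸ N)) (B : ℕ → Set G)
    (hmem : ∀ (n : ℕ) (z : G), (QuotientGroup.mk z : G ⧸ N) ∈ Ω n ↔ z ∈ B n) {m : ℕ} (hB : IsOpen (B m)) : IsOpen (Ω m) := by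
  rw [eq_image_mk_of_forall_mk_mem_iff N Ω B hmem m]
  exact QuotientGroup.isOpenMap_coe _ hB

omit [N.Normal] [IsTopologicalGroup G] in
/-- Closedness descends: if `B m` is closed then `Ω m` is closed (`mk⁻¹ (Ω m) = B m`, `mk` is a quotient map). [cite: Cartier1979, §I.3] -/
theorem isClosed_of_forall_mk_mem_iff (Ω : ℕ → Set (G ⧸ N)) (B : ℕ → Set G)
    (hmem : ∀ (n : ℕ) (z : G), (QuotientGroup.mk z : G ⧸ N) ∈ Ω n ↔ z ∈ B n) {m : ℕ} (hB : IsClosed (B m)) : IsClosed (Ω m) := by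
  refine (QuotientGroup.isQuotientMap_mk N).isClosed_preimage.1 ?_
  rwa [preimage_mk_eq_of_forall_mk_mem_iff N Ω B hmem m]

/-- The conjugation-membership set `{x̄ | x̄ ∈ Ω R ∧ x̄ · y · x̄⁻¹ ∈ Ω m}` is measurable when `Ω R`, `Ω m` are (conjugation is continuous). [folklore] -/
theorem measurableSet_setOf_mem_and_conj_mem [MeasurableSpace (G ⧸ N)] [BorelSpace (G ⧸ N)] {S T : Set (G ⧸ N)}
    (hS : MeasurableSet S) (hT : MeasurableSet T) (y : G ⧸ N) : MeasurableSet {x : G ⧸ N | x ∈ S ∧ x * y * x⁻¹ ∈ T} := by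
  have hc : Measurable fun x : G ⧸ N => x * y * x⁻¹ := ((continuous_id.mul continuous_const).mul continuous_id.inv).measurable
  exact hS.inter (hc hT)

end Algebra

/-! ## §2  Every Haar measure of `G'` is `c • (ν|_D).map mk` -/

section Transfer

variable {F : Type*} [Field F] [Valued F ℤᵐ⁰] [ValuativeRel F] [(Valued.v : Valuation F ℤᵐ⁰).Compatible] [IsNonarchimedeanLocalField F]
  [MeasurableSpace (GL (Fin 3) F)] [BorelSpace (GL (Fin 3) F)]
  {ϖ : F} (hϖ : Valued.v ϖ = WithZero.exp (-1 : ℤ)) (hϖ0 : ϖ ≠ 0) (ν : Measure (GL (Fin 3) F)) [ν.IsHaarMeasure]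
  [((Subgroup.zpowers (Units.mk0 ϖ hϖ0)).map (Matrix.GeneralLinearGroup.scalar (Fin 3))).Normal]
  [MeasurableSpace (GL (Fin 3) F ⧸ (Subgroup.zpowers (Units.mk0 ϖ hϖ0)).map (Matrix.GeneralLinearGroup.scalar (Fin 3)))]
  [BorelSpace (GL (Fin 3) F ⧸ (Subgroup.zpowers (Units.mk0 ϖ hϖ0)).map (Matrix.GeneralLinearGroup.scalar (Fin 3)))]
  (μ' : Measure (GL (Fin 3) F ⧸ (Subgroup.zpowers (Units.mk0 ϖ hϖ0)).map (Matrix.GeneralLinearGroup.scalar (Fin 3)))) [μ'.IsHaarMeasure]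

include hϖ in
/-- **HAAR UNIQUENESS ON `G'`**: every Haar measure `μ'` of `G' = GL₃(F) ⧸ ϖ^ℤ·1` is `c • (ν|_D).map mk` for some `c : ℝ≥0` (★ F2: `(ν|_D).map mk` is a Haar measure;
`G'` is second countable and locally compact). [cite: WeilIntegration1965, §8; cite: Cartier1979, §I.4] -/
theorem exists_eq_smul_map_mk_restrict :
    ∃ c : ℝ≥0, μ' = c • ((ν.restrict {g : GL (Fin 3) F | WithZero.log (Valued.v (g : Matrix (Fin 3) (Fin 3) F).det) ∈ Set.Icc (-2 : ℤ) 0}).map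
      (QuotientGroup.mk : GL (Fin 3) F → GL (Fin 3) F ⧸ (Subgroup.zpowers (Units.mk0 ϖ hϖ0)).map (Matrix.GeneralLinearGroup.scalar (Fin 3)))) := by
  haveI : SecondCountableTopology (GL (Fin 3) F) := secondCountableTopology_gl3 F
  haveI : LocallyCompactSpace (GL (Fin 3) F) := locallyCompactSpace_gl3 F
  haveI := isHaarMeasure_map_mk_restrict hϖ hϖ0 ν
  exact ⟨_, isMulLeftInvariant_eq_smul μ' _⟩

include hϖ in
/-- **`μ'(A) = c · ν(mk⁻¹ A ∩ D)`** for every measurable `A ⊆ G'`, with ONE constant `c : ℝ≥0` (depending on `μ'`, `ν` only).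
[cite: WeilIntegration1965, §7–§8; cite: Cartier1979, §I.3–I.4] -/
theorem exists_forall_measure_eq_mul_measure_preimage_inter :
    ∃ c : ℝ≥0, ∀ A : Set (GL (Fin 3) F ⧸ (Subgroup.zpowers (Units.mk0 ϖ hϖ0)).map (Matrix.GeneralLinearGroup.scalar (Fin 3))), MeasurableSet A →
      μ' A = c * ν ((QuotientGroup.mk : GL (Fin 3) F → GL (Fin 3) F ⧸ (Subgroup.zpowers (Units.mk0 ϖ hϖ0)).map (Matrix.GeneralLinearGroup.scalar (Fin 3))) ⁻¹' A ∩
        {g : GL (Fin 3) F | WithZero.log (Valued.v (g : Matrix (Fin 3) (Fin 3) F).det) ∈ Set.Icc (-2 : ℤ) 0}) := by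
  obtain ⟨c, hc⟩ := exists_eq_smul_map_mk_restrict hϖ hϖ0 ν μ'
  refine ⟨c, fun A hA => ?_⟩
  rw [hc, Measure.smul_apply, map_mk_restrict_apply hϖ0 ν hA, ENNReal.smul_def, smul_eq_mul]

/-! ## §3  The brick: volumes of conjugation-membership sets of `G'`, read upstairs on `D` -/

include hϖ in
/-- **VOL-TRANSFER.**  For an abstract exhaustion `Ω : ℕ → Set G'` with membership law `mk z ∈ Ω n ↔ z ∈ B n` (`B n ⊆ GL₃(F)` open — for the road `B n = 𝔅_n`,
★ B4-0), ANY Haar measure `μ'` of `G'` and a Haar measure `ν` of `GL₃(F)`: there is ONE `c : ℝ≥0` with, for all `g : GL₃(F)` and `R m : ℕ`,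
`μ' {x̄ | x̄ ∈ Ω R ∧ x̄ · mk g · x̄⁻¹ ∈ Ω m} = c · ν {z | log v(det z) ∈ [−2, 0] ∧ z ∈ B R ∧ z g z⁻¹ ∈ B m}`.
[cite: WeilIntegration1965, §7–§8; cite: HarishChandra1970, Part VII §3 p. 70] -/
theorem exists_forall_measure_setOf_mem_and_conj_mem_eq
    (Ω : ℕ → Set (GL (Fin 3) F ⧸ (Subgroup.zpowers (Units.mk0 ϖ hϖ0)).map (Matrix.GeneralLinearGroup.scalar (Fin 3)))) (B : ℕ → Set (GL (Fin 3) F))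
    (hmem : ∀ (n : ℕ) (z : GL (Fin 3) F),
      (QuotientGroup.mk z : GL (Fin 3) F ⧸ (Subgroup.zpowers (Units.mk0 ϖ hϖ0)).map (Matrix.GeneralLinearGroup.scalar (Fin 3))) ∈ Ω n ↔ z ∈ B n)
    (hB : ∀ n, IsOpen (B n)) :
    ∃ c : ℝ≥0, ∀ (g : GL (Fin 3) F) (R m : ℕ),
      μ' {x | x ∈ Ω R ∧ x * QuotientGroup.mk g * x⁻¹ ∈ Ω m} =
        c * ν {z : GL (Fin 3) F | WithZero.log (Valued.v (z : Matrix (Fin 3) (Fin 3) F).det) ∈ Set.Icc (-2 : ℤ) 0 ∧ z ∈ B R ∧ z * g * z⁻¹ ∈ B m} := by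
  obtain ⟨c, hc⟩ := exists_forall_measure_eq_mul_measure_preimage_inter hϖ hϖ0 ν μ'
  refine ⟨c, fun g R m => ?_⟩
  have hΩ : ∀ n, MeasurableSet (Ω n) := fun n => (isOpen_of_forall_mk_mem_iff _ Ω B hmem (hB n)).measurableSet
  rw [hc _ (measurableSet_setOf_mem_and_conj_mem _ (hΩ R) (hΩ m) _), preimage_mk_setOf_mem_and_conj_mem _ Ω B hmem g R m]
  congr 2
  ext z
  simp only [Set.mem_inter_iff, Set.mem_setOf_eq]
  tauto

omit [ValuativeRel F] [(Valued.v : Valuation F ℤᵐ⁰).Compatible] [IsNonarchimedeanLocalField F] [MeasurableSpace (GL (Fin 3) F)] [BorelSpace (GL (Fin 3) F)]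
  [ν.IsHaarMeasure] [μ'.IsHaarMeasure] in
/-- **The `lintegral` form**: `∫⁻ x̄ in Ω R, 𝟙_{Ω m}(x̄ · y · x̄⁻¹) ∂μ' = μ' {x̄ | x̄ ∈ Ω R ∧ x̄ · y · x̄⁻¹ ∈ Ω m}` for measurable `Ω m`.
[cite: HarishChandra1970, Part VII §3 p. 70] -/
theorem lintegral_indicator_comp_conj_eq
    (Ω : ℕ → Set (GL (Fin 3) F ⧸ (Subgroup.zpowers (Units.mk0 ϖ hϖ0)).map (Matrix.GeneralLinearGroup.scalar (Fin 3)))) {m : ℕ} (hΩm : MeasurableSet (Ω m))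
    (y : GL (Fin 3) F ⧸ (Subgroup.zpowers (Units.mk0 ϖ hϖ0)).map (Matrix.GeneralLinearGroup.scalar (Fin 3))) (R : ℕ) :
    ∫⁻ x in Ω R, (Ω m).indicator (1 : GL (Fin 3) F ⧸ (Subgroup.zpowers (Units.mk0 ϖ hϖ0)).map (Matrix.GeneralLinearGroup.scalar (Fin 3)) → ℝ≥0∞) (x * y * x⁻¹) ∂μ' =
      μ' {x | x ∈ Ω R ∧ x * y * x⁻¹ ∈ Ω m} := by
  have hc : Measurable fun x : GL (Fin 3) F ⧸ (Subgroup.zpowers (Units.mk0 ϖ hϖ0)).map (Matrix.GeneralLinearGroup.scalar (Fin 3)) => x * y * x⁻¹ :=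
    ((continuous_id.mul continuous_const).mul continuous_id.inv).measurable
  have hS : MeasurableSet {x : GL (Fin 3) F ⧸ (Subgroup.zpowers (Units.mk0 ϖ hϖ0)).map (Matrix.GeneralLinearGroup.scalar (Fin 3)) | x * y * x⁻¹ ∈ Ω m} :=
    hc hΩm
  have hfun : (fun x : GL (Fin 3) F ⧸ (Subgroup.zpowers (Units.mk0 ϖ hϖ0)).map (Matrix.GeneralLinearGroup.scalar (Fin 3)) =>
      (Ω m).indicator (1 : GL (Fin 3) F ⧸ (Subgroup.zpowers (Units.mk0 ϖ hϖ0)).map (Matrix.GeneralLinearGroup.scalar (Fin 3)) → ℝ≥0∞) (x * y * x⁻¹)) =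
        {x : GL (Fin 3) F ⧸ (Subgroup.zpowers (Units.mk0 ϖ hϖ0)).map (Matrix.GeneralLinearGroup.scalar (Fin 3)) | x * y * x⁻¹ ∈ Ω m}.indicator 1 := by
    funext x
    by_cases hx : x * y * x⁻¹ ∈ Ω m
    · rw [Set.indicator_of_mem hx, Set.indicator_of_mem (show x ∈ {x | x * y * x⁻¹ ∈ Ω m} from hx), Pi.one_apply, Pi.one_apply]
    · rw [Set.indicator_of_notMem hx, Set.indicator_of_notMem (show x ∉ {x | x * y * x⁻¹ ∈ Ω m} from hx)]
  rw [hfun, lintegral_indicator_one hS, Measure.restrict_apply hS]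
  congr 1
  ext x
  simp only [Set.mem_inter_iff, Set.mem_setOf_eq]
  tauto

omit [ValuativeRel F] [(Valued.v : Valuation F ℤᵐ⁰).Compatible] [IsNonarchimedeanLocalField F] [MeasurableSpace (GL (Fin 3) F)] [BorelSpace (GL (Fin 3) F)]
  [ν.IsHaarMeasure] [μ'.IsHaarMeasure] in
/-- **The Bochner form (what ASM's (hball) eats)**: for `θ : G' → E` bounded by `M`, vanishing off `Ω m`, and `Ω R` measurable of finite `μ'`-measure,
`∫ x̄ in Ω R, ‖θ (x̄ · y · x̄⁻¹)‖ ∂μ' ≤ M · (μ' {x̄ | x̄ ∈ Ω R ∧ x̄ · y · x̄⁻¹ ∈ Ω m}).toReal`. [cite: HarishChandra1970, Part VII §3 p. 70] -/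
theorem setIntegral_norm_comp_conj_le {E : Type*} [NormedAddCommGroup E]
    (Ω : ℕ → Set (GL (Fin 3) F ⧸ (Subgroup.zpowers (Units.mk0 ϖ hϖ0)).map (Matrix.GeneralLinearGroup.scalar (Fin 3)))) {R m : ℕ}
    (hΩR : MeasurableSet (Ω R)) (hfin : μ' (Ω R) < ∞)
    (θ : GL (Fin 3) F ⧸ (Subgroup.zpowers (Units.mk0 ϖ hϖ0)).map (Matrix.GeneralLinearGroup.scalar (Fin 3)) → E) {M : ℝ} (hM : ∀ x, ‖θ x‖ ≤ M)
    (hsupp : ∀ x, x ∉ Ω m → θ x = 0) (y : GL (Fin 3) F ⧸ (Subgroup.zpowers (Units.mk0 ϖ hϖ0)).map (Matrix.GeneralLinearGroup.scalar (Fin 3))) :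
    ∫ x in Ω R, ‖θ (x * y * x⁻¹)‖ ∂μ' ≤ M * (μ' {x | x ∈ Ω R ∧ x * y * x⁻¹ ∈ Ω m}).toReal := by
  have hc : Measurable fun x : GL (Fin 3) F ⧸ (Subgroup.zpowers (Units.mk0 ϖ hϖ0)).map (Matrix.GeneralLinearGroup.scalar (Fin 3)) => x * y * x⁻¹ :=
    ((continuous_id.mul continuous_const).mul continuous_id.inv).measurable
  set S : Set (GL (Fin 3) F ⧸ (Subgroup.zpowers (Units.mk0 ϖ hϖ0)).map (Matrix.GeneralLinearGroup.scalar (Fin 3))) :=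
    {x | x ∈ Ω R ∧ x * y * x⁻¹ ∈ Ω m} with hSdef
  have hSsub : S ⊆ Ω R := fun x hx => hx.1
  have hSfin : μ' S < ∞ := (measure_mono hSsub).trans_lt hfin
  -- the integrand vanishes on `Ω R ∖ S`
  have hzero : ∀ x ∈ Ω R \ S, ‖θ (x * y * x⁻¹)‖ = 0 := by
    intro x hx
    have hx' : x * y * x⁻¹ ∉ Ω m := fun h => hx.2 ⟨hx.1, h⟩
    rw [hsupp _ hx', norm_zero]
  rw [setIntegral_eq_of_subset_of_forall_sdiff_eq_zero hΩR hSsub hzero]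
  have hle := norm_setIntegral_le_of_norm_le_const (f := fun x => ‖θ (x * y * x⁻¹)‖) hSfin (C := M) fun x _ => by
    rw [norm_norm]; exact hM _
  rw [measureReal_def] at hle
  exact (Real.le_norm_self _).trans hle

/-! ## §4  The road's case: the Ad-height balls `B = 𝔅`, `Ω = mk(𝔅)` (★ B4-0) -/

include hϖ in
/-- **VOL-TRANSFER FOR THE AD-HEIGHT EXHAUSTION** (`𝔅_n(g) :≡ ∀ i j k l, |ϖ^n g_{ij} (g⁻¹)_{kl}| ≤ 1`, `mk g ∈ Ω n ↔ 𝔅_n(g)` — conjunct (i) of ★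
`exists_adHeightBall_compactExhaustion_quotScalar`): for ANY Haar measure `μ'` of `G'` there is ONE `c : ℝ≥0` with, for all `g, R, m`,
`μ' {x̄ ∈ Ω R | x̄ · mk g · x̄⁻¹ ∈ Ω m} = c · ν {z | log v(det z) ∈ [−2, 0] ∧ 𝔅_R(z) ∧ 𝔅_m(z g z⁻¹)}`.
[cite: HarishChandra1970, Part VII §3 p. 70; cite: WeilIntegration1965, §7–§8] -/
theorem exists_forall_measure_adBall_conj_eq
    (Ω : ℕ → Set (GL (Fin 3) F ⧸ (Subgroup.zpowers (Units.mk0 ϖ hϖ0)).map (Matrix.GeneralLinearGroup.scalar (Fin 3))))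
    (hmem : ∀ (n : ℕ) (z : GL (Fin 3) F),
      (QuotientGroup.mk z : GL (Fin 3) F ⧸ (Subgroup.zpowers (Units.mk0 ϖ hϖ0)).map (Matrix.GeneralLinearGroup.scalar (Fin 3))) ∈ Ω n ↔
        ∀ i j k l, Valued.v (ϖ ^ n * ((z : Matrix (Fin 3) (Fin 3) F) i j * ((z⁻¹ : GL (Fin 3) F) : Matrix (Fin 3) (Fin 3) F) k l)) ≤ 1) :
    ∃ c : ℝ≥0, ∀ (g : GL (Fin 3) F) (R m : ℕ),
      μ' {x | x ∈ Ω R ∧ x * QuotientGroup.mk g * x⁻¹ ∈ Ω m} =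
        c * ν {z : GL (Fin 3) F | WithZero.log (Valued.v (z : Matrix (Fin 3) (Fin 3) F).det) ∈ Set.Icc (-2 : ℤ) 0 ∧
          (∀ i j k l, Valued.v (ϖ ^ R * ((z : Matrix (Fin 3) (Fin 3) F) i j * ((z⁻¹ : GL (Fin 3) F) : Matrix (Fin 3) (Fin 3) F) k l)) ≤ 1) ∧
          ∀ i j k l, Valued.v (ϖ ^ m * (((z * g * z⁻¹ : GL (Fin 3) F) : Matrix (Fin 3) (Fin 3) F) i j *
            (((z * g * z⁻¹)⁻¹ : GL (Fin 3) F) : Matrix (Fin 3) (Fin 3) F) k l)) ≤ 1} :=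
  exists_forall_measure_setOf_mem_and_conj_mem_eq hϖ hϖ0 ν μ' Ω
    (fun n => {z : GL (Fin 3) F | ∀ i j k l, Valued.v (ϖ ^ n * ((z : Matrix (Fin 3) (Fin 3) F) i j * ((z⁻¹ : GL (Fin 3) F) : Matrix (Fin 3) (Fin 3) F) k l)) ≤ 1})
    hmem fun n => isOpen_setOf_adBall ϖ n

include hϖ in
/-- **The Bochner form for the Ad-height exhaustion, hypothesis-free**: `Ω R = mk(𝔅_R)` is clopen and COMPACT (★ B4-0 `isCompact_image_mk_setOf_adBall`, ★ B0z
`F^× ⧸ ϖ^ℤ` compact), so for `θ` bounded by `M` and vanishing off `Ω m`: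
`∫ x̄ in Ω R, ‖θ (x̄ · mk g · x̄⁻¹)‖ ∂μ' ≤ M · (c · ν {z | log v(det z) ∈ [−2, 0] ∧ 𝔅_R(z) ∧ 𝔅_m(z g z⁻¹)}).toReal` with the constant `c` of
`exists_forall_measure_adBall_conj_eq`. [cite: HarishChandra1970, Part VII §3 p. 70] -/
theorem setIntegral_norm_comp_conj_le_adBall {E : Type*} [NormedAddCommGroup E]
    (Ω : ℕ → Set (GL (Fin 3) F ⧸ (Subgroup.zpowers (Units.mk0 ϖ hϖ0)).map (Matrix.GeneralLinearGroup.scalar (Fin 3))))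
    (hmem : ∀ (n : ℕ) (z : GL (Fin 3) F),
      (QuotientGroup.mk z : GL (Fin 3) F ⧸ (Subgroup.zpowers (Units.mk0 ϖ hϖ0)).map (Matrix.GeneralLinearGroup.scalar (Fin 3))) ∈ Ω n ↔
        ∀ i j k l, Valued.v (ϖ ^ n * ((z : Matrix (Fin 3) (Fin 3) F) i j * ((z⁻¹ : GL (Fin 3) F) : Matrix (Fin 3) (Fin 3) F) k l)) ≤ 1) :
    ∃ c : ℝ≥0, ∀ (θ : GL (Fin 3) F ⧸ (Subgroup.zpowers (Units.mk0 ϖ hϖ0)).map (Matrix.GeneralLinearGroup.scalar (Fin 3)) → E) (M : ℝ) (m : ℕ),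
      (∀ x, ‖θ x‖ ≤ M) → (∀ x, x ∉ Ω m → θ x = 0) → ∀ (g : GL (Fin 3) F) (R : ℕ),
        ∫ x in Ω R, ‖θ (x * QuotientGroup.mk g * x⁻¹)‖ ∂μ' ≤
          M * (c * ν {z : GL (Fin 3) F | WithZero.log (Valued.v (z : Matrix (Fin 3) (Fin 3) F).det) ∈ Set.Icc (-2 : ℤ) 0 ∧
            (∀ i j k l, Valued.v (ϖ ^ R * ((z : Matrix (Fin 3) (Fin 3) F) i j * ((z⁻¹ : GL (Fin 3) F) : Matrix (Fin 3) (Fin 3) F) k l)) ≤ 1) ∧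
            ∀ i j k l, Valued.v (ϖ ^ m * (((z * g * z⁻¹ : GL (Fin 3) F) : Matrix (Fin 3) (Fin 3) F) i j *
              (((z * g * z⁻¹)⁻¹ : GL (Fin 3) F) : Matrix (Fin 3) (Fin 3) F) k l)) ≤ 1}).toReal := by
  obtain ⟨c, hc⟩ := exists_forall_measure_adBall_conj_eq hϖ hϖ0 ν μ' Ω hmem
  refine ⟨c, fun θ M m hM hsupp g R => ?_⟩
  -- `Ω n = mk '' 𝔅_n` is open (measurable) and compact
  have heq : ∀ n, Ω n = (QuotientGroup.mk : GL (Fin 3) F → GL (Fin 3) F ⧸ (Subgroup.zpowers (Units.mk0 ϖ hϖ0)).map (Matrix.GeneralLinearGroup.scalar (Fin 3))) ''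
      {z : GL (Fin 3) F | ∀ i j k l, Valued.v (ϖ ^ n * ((z : Matrix (Fin 3) (Fin 3) F) i j * ((z⁻¹ : GL (Fin 3) F) : Matrix (Fin 3) (Fin 3) F) k l)) ≤ 1} :=
    fun n => eq_image_mk_of_forall_mk_mem_iff _ Ω _ hmem n
  have hΩ : ∀ n, MeasurableSet (Ω n) := fun n => by
    rw [heq n]
    exact (isOpen_image_mk_setOf_adBall _ ϖ n).measurableSet
  haveI : CompactSpace (Fˣ ⧸ Subgroup.zpowers (Units.mk0 ϖ hϖ0)) := compactSpace_units_quot_zpowers_uniformizer hϖ hϖ0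
  have hcpt : IsCompact (Ω R) := by
    rw [heq R]
    exact isCompact_image_mk_setOf_adBall _ hϖ R
  rw [← hc g R m]
  exact setIntegral_norm_comp_conj_le hϖ0 μ' Ω (hΩ R) hcpt.measure_lt_top θ hM hsupp _

end Transfer

end Summit.HodgeConjecture.HodgeConjecture.Cruxes.H413.K2E3GL3ModUniformizerVolumeTransfer

end
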